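import Summits.Ventures.PercRepro.RankLevelSetRuleQSliceBinom
import Summits.Ventures.PercRepro.RankLevelSetRuleQSliceRho

/-!
# PercRepro — THE BORDERLINE PATH IS AFFINE IN `ρ`: THE CONJECTURE OF RECORD REDUCED TO TWO EXPLICIT RATIONAL INEQUALITIES
(night-1, gen 20; dossier §31.9)

With `ρ(n, r) = (Σ_{i ≤ r} C(n, i))/C(n, r)`, the borderline identity `L − Φ(q+k, q) = 1 + ρ(2q+k, q) − ρ(2q−k+2, q−k+2) − T`
(RankLevelSetRuleQSliceBinom) and the ρ-calculus (RankLevelSetRuleQSliceRho):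
(the A-step identity `rho_stepA` and the path formula `rho_path_eq` live in RankLevelSetRuleQSliceRho):
* **`border_sub_phiK_ge_min`** — on the borderline `m = q − k + 2` (`k = k'+2`, `q = m + k'`), with `A = Π_{i ≤ k'} s(m+i)`,
  `B = Σ_{i ≤ k'} c(m+i)·Π_{i<l≤k'} s(m+l)`, `Path(x) = (A·x + B − 1)·(q+k)/(q+1)` and `U = (q+1)/(k−1)`:
  `L − Φ(q+k, q) ≥ min (Path 1) (Path U − U + 1) − T` — because `L − Φ + T = Path(ρ′) − ρ′ + 1` is affine in
  `ρ′ = ρ(2q−k+2, q−k+2)` and `1 ≤ ρ′ ≤ U` (`rho_ge_one`, `rho_le_geom`);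
* **`phiK_le_rhat_border_of_min`** — hence `Φ(q+k, q) ≤ R̂(q, k, q−k+2)` whenever `T ≤ min (Path 1) (Path U − U + 1)`.
The conjecture of record (dossier §28.7) is therefore implied by two explicit inequalities between rational functions of
`(q, k)` and the tail `T` (numerically true on every cell `k ≤ 16`, `q ≤ 200`, with equality at `q = k − 2`; the large-`q`
half — `q ≥ k(k−3)/2`, where every slope is `≥ 1` and `Path 1 ≥ (k−1)(k−3)/(4(q+1))` — is §31.9(c)). AND THE REGIME `q ≥ k(k−3)/2` (every slope `≥ 1`): `borderPath_slope_ge_one` ((k'+1)(k'−2) ≤ 2r ⇒ s(r) ≥ 1), `borderPath_intercept_ge`,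
**`path_one_ge`** (`Path 1 ≥ (k−1)(k−3)/(4(q+1))`), `border_sub_phiK_ge_path_one` (`L − Φ ≥ Path 1 − T` there),
**`phiK_le_rhat_border_of_tail`** (`T ≤ (k−1)(k−3)/(4(q+1))` ⇒ `Φ(q+k, q) ≤ R̂(q, k, q−k+2)` on that regime). Axioms: standard.
-/

namespace PercRepro

open Finset

/-- **THE REDUCTION**: on the borderline `m = q − k + 2` (`k = k' + 2`, `q = m + k'`, `1 ≤ m + k'`), with the path
coefficients `A = Π_{i ≤ k'} s(m+i)`, `B = Σ_{i ≤ k'} c(m+i)·Π_{i<l≤k'} s(m+l)`, the factor `κ = (q+k)/(q+1)`, `Path(x) = (A·x + B − 1)·κ`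
and `U = (q+1)/(k−1)`:
`L − Φ(q+k, q) ≥ min (Path 1) (Path U − U + 1) − T` — the affine function `Path(ρ′) − ρ′` of `ρ′ = ρ(2q−k+2, q−k+2) ∈ [1, U]`
is at least its value at an endpoint. -/
theorem border_sub_phiK_ge_min (m k' : ℕ) (h : 1 ≤ m + k') :
    (∑ j ∈ range (k' + 1), ((2 * k' + 2).choose (j + 1) : ℚ)
        * ∑ a ∈ range (m + 1), (m.choose a : ℚ) / ((m + k' + (j + 1) + a).choose (a + (j + 1)) : ℚ))
      - phiK (m + k' + (k' + 2)) (m + k')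
      ≥ min (((∏ i ∈ range (k' + 1), (4 * (((m + i : ℕ) : ℚ) + 1) * (((m + i : ℕ) : ℚ) + k' + 1)
              / ((2 * ((m + i : ℕ) : ℚ) + k' + 1) * (2 * ((m + i : ℕ) : ℚ) + k' + 2)))) * 1
            + ∑ i ∈ range (k' + 1), ((((m + i : ℕ) : ℚ) + k' + 1) * ((k' : ℚ) - 1)
              / ((2 * ((m + i : ℕ) : ℚ) + k' + 1) * (2 * ((m + i : ℕ) : ℚ) + k' + 2)))
              * ∏ l ∈ Finset.Ico (i + 1) (k' + 1), (4 * (((m + l : ℕ) : ℚ) + 1) * (((m + l : ℕ) : ℚ) + k' + 1)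
              / ((2 * ((m + l : ℕ) : ℚ) + k' + 1) * (2 * ((m + l : ℕ) : ℚ) + k' + 2))) - 1)
            * (((m : ℚ) + 2 * k' + 2) / ((m : ℚ) + k' + 1)))
          (((∏ i ∈ range (k' + 1), (4 * (((m + i : ℕ) : ℚ) + 1) * (((m + i : ℕ) : ℚ) + k' + 1)
              / ((2 * ((m + i : ℕ) : ℚ) + k' + 1) * (2 * ((m + i : ℕ) : ℚ) + k' + 2))))
              * (((m : ℚ) + k' + 1) / ((k' : ℚ) + 1))
            + ∑ i ∈ range (k' + 1), ((((m + i : ℕ) : ℚ) + k' + 1) * ((k' : ℚ) - 1)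
              / ((2 * ((m + i : ℕ) : ℚ) + k' + 1) * (2 * ((m + i : ℕ) : ℚ) + k' + 2)))
              * ∏ l ∈ Finset.Ico (i + 1) (k' + 1), (4 * (((m + l : ℕ) : ℚ) + 1) * (((m + l : ℕ) : ℚ) + k' + 1)
              / ((2 * ((m + l : ℕ) : ℚ) + k' + 1) * (2 * ((m + l : ℕ) : ℚ) + k' + 2))) - 1)
            * (((m : ℚ) + 2 * k' + 2) / ((m : ℚ) + k' + 1)) - ((m : ℚ) + k' + 1) / ((k' : ℚ) + 1) + 1)
        - ∑ j ∈ range (k' + 1), ((2 * k' + 2).choose (k' + 2 + j) : ℚ)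
            * ∑ a ∈ range (m + 1), (m.choose a : ℚ) / ((m + k' + (k' + 2 + j) + a).choose (a + (k' + 2 + j)) : ℚ) := by
  have hb := border_sub_phiK_eq m k'
  have hp := rho_path_eq k' m h (k' + 1)
  rw [show 2 * (m + (k' + 1)) + k' = 2 * m + 3 * k' + 2 by ring, show m + (k' + 1) = m + k' + 1 by ring] at hp
  have hs := rho_succ (2 * m + 3 * k' + 2) (m + k') (by omega)
  rw [show ((2 * m + 3 * k' + 2 : ℕ) : ℚ) - ((m + k' : ℕ) : ℚ) = (m : ℚ) + 2 * k' + 2 by push_cast; ring] at hs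
  set A := ∏ i ∈ range (k' + 1), (4 * (((m + i : ℕ) : ℚ) + 1) * (((m + i : ℕ) : ℚ) + k' + 1)
      / ((2 * ((m + i : ℕ) : ℚ) + k' + 1) * (2 * ((m + i : ℕ) : ℚ) + k' + 2))) with hA
  set B := ∑ i ∈ range (k' + 1), ((((m + i : ℕ) : ℚ) + k' + 1) * ((k' : ℚ) - 1)
      / ((2 * ((m + i : ℕ) : ℚ) + k' + 1) * (2 * ((m + i : ℕ) : ℚ) + k' + 2)))
      * ∏ l ∈ Finset.Ico (i + 1) (k' + 1), (4 * (((m + l : ℕ) : ℚ) + 1) * (((m + l : ℕ) : ℚ) + k' + 1)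
      / ((2 * ((m + l : ℕ) : ℚ) + k' + 1) * (2 * ((m + l : ℕ) : ℚ) + k' + 2))) with hB
  set ρ' := (∑ i ∈ range (m + 1), ((2 * m + k').choose i : ℚ)) / ((2 * m + k').choose m : ℚ) with hρ'
  set ρq := (∑ i ∈ range (m + k' + 1), ((2 * m + 3 * k' + 2).choose i : ℚ)) / ((2 * m + 3 * k' + 2).choose (m + k') : ℚ) with hρq
  set T := ∑ j ∈ range (k' + 1), ((2 * k' + 2).choose (k' + 2 + j) : ℚ)
      * ∑ a ∈ range (m + 1), (m.choose a : ℚ) / ((m + k' + (k' + 2 + j) + a).choose (a + (k' + 2 + j)) : ℚ) with hT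
  set κ := ((m : ℚ) + 2 * k' + 2) / ((m : ℚ) + k' + 1) with hκ
  set U := ((m : ℚ) + k' + 1) / ((k' : ℚ) + 1) with hU
  -- ρ(2q+k, q+1) = A ρ' + B and ρ(2q+k, q+1) = 1 + ρq / κ
  have hq1 : (∑ i ∈ range (m + k' + 1 + 1), ((2 * m + 3 * k' + 2).choose i : ℚ))
      / ((2 * m + 3 * k' + 2).choose (m + k' + 1) : ℚ) = A * ρ' + B := hp
  have hκpos : 0 < κ := by rw [hκ]; positivity
  have hρq_eq : ρq = (A * ρ' + B - 1) * κ := by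
    have e := hq1.symm.trans hs
    push_cast at e
    have hd : (0 : ℚ) < (m : ℚ) + 2 * k' + 2 := by positivity
    have e2 : (A * ρ' + B - 1) * ((m : ℚ) + 2 * k' + 2) = ((m : ℚ) + k' + 1) * ρq := by
      have e3 : (A * ρ' + B) * ((m : ℚ) + 2 * k' + 2) = ((m : ℚ) + 2 * k' + 2) + ((m : ℚ) + k' + 1) * ρq := by
        rw [e]
        field_simp
      linarith [e3]
    rw [hκ, mul_div_assoc', eq_div_iff (by positivity)]
    linarith [e2]
  -- the bounds on ρ'
  have h1 : (1 : ℚ) ≤ ρ' := rho_ge_one (2 * m + k') m (by omega)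
  have hU' : ρ' ≤ U := by
    have := rho_le_geom (2 * m + k') m (by omega)
    rw [hU]
    have e : ((2 * m + k' : ℕ) : ℚ) - m + 1 = (m : ℚ) + k' + 1 := by push_cast; ring
    have e2 : ((2 * m + k' : ℕ) : ℚ) - 2 * m + 1 = (k' : ℚ) + 1 := by push_cast; ring
    rw [e, e2] at this
    exact this
  -- L − Φ = 1 + ρq − ρ' − T, affine in ρ'
  rw [hb]
  have hlin : (1 : ℚ) + ρq - ρ' - T = (A * κ - 1) * ρ' + (B - 1) * κ + 1 - T := by rw [hρq_eq]; ring
  rw [hlin]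
  by_cases hpos : 0 ≤ A * κ - 1
  · -- slope ≥ 0: the minimum at ρ' = 1
    have : (A * κ - 1) * 1 ≤ (A * κ - 1) * ρ' := mul_le_mul_of_nonneg_left h1 hpos
    have hmin := min_le_left ((A * 1 + B - 1) * κ) ((A * U + B - 1) * κ - U + 1)
    linarith
  · -- slope < 0: the minimum at ρ' = U
    have hneg : A * κ - 1 < 0 := not_le.mp hpos
    have : (A * κ - 1) * U ≤ (A * κ - 1) * ρ' := by nlinarith
    have hmin := min_le_right ((A * 1 + B - 1) * κ) ((A * U + B - 1) * κ - U + 1)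
    linarith

/-- **The conjecture of record from the two explicit inequalities**: on the borderline (`k = k' + 2`, `q = m + k'`), if the
tail `T` is at most `min (Path 1) (Path U − U + 1)` then `Φ(q+k, q) ≤ R̂(q, k, q−k+2)`. -/
theorem phiK_le_rhat_border_of_min (m k' : ℕ) (h : 1 ≤ m + k')
    (hT : ∑ j ∈ range (k' + 1), ((2 * k' + 2).choose (k' + 2 + j) : ℚ)
            * ∑ a ∈ range (m + 1), (m.choose a : ℚ) / ((m + k' + (k' + 2 + j) + a).choose (a + (k' + 2 + j)) : ℚ)
      ≤ min (((∏ i ∈ range (k' + 1), (4 * (((m + i : ℕ) : ℚ) + 1) * (((m + i : ℕ) : ℚ) + k' + 1)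
              / ((2 * ((m + i : ℕ) : ℚ) + k' + 1) * (2 * ((m + i : ℕ) : ℚ) + k' + 2)))) * 1
            + ∑ i ∈ range (k' + 1), ((((m + i : ℕ) : ℚ) + k' + 1) * ((k' : ℚ) - 1)
              / ((2 * ((m + i : ℕ) : ℚ) + k' + 1) * (2 * ((m + i : ℕ) : ℚ) + k' + 2)))
              * ∏ l ∈ Finset.Ico (i + 1) (k' + 1), (4 * (((m + l : ℕ) : ℚ) + 1) * (((m + l : ℕ) : ℚ) + k' + 1)
              / ((2 * ((m + l : ℕ) : ℚ) + k' + 1) * (2 * ((m + l : ℕ) : ℚ) + k' + 2))) - 1)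
            * (((m : ℚ) + 2 * k' + 2) / ((m : ℚ) + k' + 1)))
          (((∏ i ∈ range (k' + 1), (4 * (((m + i : ℕ) : ℚ) + 1) * (((m + i : ℕ) : ℚ) + k' + 1)
              / ((2 * ((m + i : ℕ) : ℚ) + k' + 1) * (2 * ((m + i : ℕ) : ℚ) + k' + 2))))
              * (((m : ℚ) + k' + 1) / ((k' : ℚ) + 1))
            + ∑ i ∈ range (k' + 1), ((((m + i : ℕ) : ℚ) + k' + 1) * ((k' : ℚ) - 1)
              / ((2 * ((m + i : ℕ) : ℚ) + k' + 1) * (2 * ((m + i : ℕ) : ℚ) + k' + 2)))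
              * ∏ l ∈ Finset.Ico (i + 1) (k' + 1), (4 * (((m + l : ℕ) : ℚ) + 1) * (((m + l : ℕ) : ℚ) + k' + 1)
              / ((2 * ((m + l : ℕ) : ℚ) + k' + 1) * (2 * ((m + l : ℕ) : ℚ) + k' + 2))) - 1)
            * (((m : ℚ) + 2 * k' + 2) / ((m : ℚ) + k' + 1)) - ((m : ℚ) + k' + 1) / ((k' : ℚ) + 1) + 1)) :
    phiK (m + k' + (k' + 2)) (m + k') ≤ rhat (m + k') (k' + 2) m := by
  have hge := border_sub_phiK_ge_min m k' h
  have hL := rhatSliceL_le_rhat (m + k') (k' + 2) m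
  rw [sum_Ioo_nat, show k' + 2 - (0 + 1) = k' + 1 by omega, show m + k' + (k' + 2) - m = 2 * k' + 2 by omega] at hL
  simp only [zero_add] at hL
  have hre : ∑ j ∈ range (k' + 1), ((2 * k' + 2).choose (1 + j) : ℚ)
        * ∑ a ∈ range (m + 1), (m.choose a : ℚ) / ((m + k' + (1 + j) + a).choose (a + (1 + j)) : ℚ)
      = ∑ j ∈ range (k' + 1), ((2 * k' + 2).choose (j + 1) : ℚ)
        * ∑ a ∈ range (m + 1), (m.choose a : ℚ) / ((m + k' + (j + 1) + a).choose (a + (j + 1)) : ℚ) :=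
    Finset.sum_congr rfl (fun j _ => by rw [Nat.add_comm 1 j])
  rw [hre] at hL
  linarith [hge, hL, hT]

/-! ### The regime `q ≥ k(k−3)/2`: every slope `≥ 1` and `Path(1) ≥ (k−1)(k−3)/(4(q+1))` (dossier §31.9(c)) -/

/-- The A-slope on the diagonal is `≥ 1` as soon as `(k'+1)(k'−2) ≤ 2r`: `4(r+1)(r+k'+1) ≥ (2r+k'+1)(2r+k'+2)`. -/
lemma borderPath_slope_ge_one (k' r : ℕ) (h : (k' + 1) * (k' - 2) ≤ 2 * r) (hk : 2 ≤ k') :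
    (1 : ℚ) ≤ 4 * ((r : ℚ) + 1) * ((r : ℚ) + k' + 1) / ((2 * (r : ℚ) + k' + 1) * (2 * (r : ℚ) + k' + 2)) := by
  rw [le_div_iff₀ (by positivity), one_mul]
  have h' : ((k' : ℚ) + 1) * ((k' : ℚ) - 2) ≤ 2 * r := by
    have := h
    have e : ((k' + 1) * (k' - 2) : ℕ) = (k' + 1) * (k' - 2) := rfl
    have hc : (((k' + 1) * (k' - 2) : ℕ) : ℚ) = ((k' : ℚ) + 1) * ((k' : ℚ) - 2) := by
      push_cast [Nat.cast_sub hk]; ring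
    rw [← hc]; exact_mod_cast this
  nlinarith [h']

/-- The A-intercept on the diagonal is at least `(k'−1)/(4(r+k'+2))` (`k' ≥ 1`). -/
lemma borderPath_intercept_ge (k' r : ℕ) (hk : 1 ≤ k') :
    ((k' : ℚ) - 1) / (4 * ((r : ℚ) + k' + 2))
      ≤ ((r : ℚ) + k' + 1) * ((k' : ℚ) - 1) / ((2 * (r : ℚ) + k' + 1) * (2 * (r : ℚ) + k' + 2)) := by
  have hk' : (1 : ℚ) ≤ k' := by exact_mod_cast hk
  rw [div_le_div_iff₀ (by positivity) (by positivity)]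
  have : (0 : ℚ) ≤ (k' : ℚ) - 1 := by linarith
  nlinarith [mul_nonneg this (Nat.cast_nonneg (α := ℚ) r), mul_nonneg this (Nat.cast_nonneg (α := ℚ) k'),
    mul_nonneg (mul_nonneg this (Nat.cast_nonneg (α := ℚ) r)) (Nat.cast_nonneg (α := ℚ) k')]

/-- A product of rationals `≥ 1` is `≥ 1`. -/
lemma borderPath_one_le_prod (s : Finset ℕ) (f : ℕ → ℚ) (h : ∀ i ∈ s, 1 ≤ f i) : 1 ≤ ∏ i ∈ s, f i := by
  have := Finset.prod_le_prod (s := s) (f := fun _ => (1 : ℚ)) (g := f) (fun _ _ => zero_le_one) h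
  simpa using this

/-- **`Path(1) ≥ (k−1)(k−3)/(4(q+1))` on the regime where every slope is `≥ 1`** (`q ≥ k(k−3)/2`, i.e. `(k'+1)(k'−2) ≤ 2m`):
the product `A ≥ 1`, every inner product `≥ 1`, and the intercepts sum to at least `(k'+1)(k'−1)/(4(m+2k'+2))`. -/
theorem path_one_ge (m k' : ℕ) (hk : 2 ≤ k') (hslope : (k' + 1) * (k' - 2) ≤ 2 * m) :
    ((k' : ℚ) + 1) * ((k' : ℚ) - 1) / (4 * ((m : ℚ) + k' + 1))
      ≤ ((∏ i ∈ range (k' + 1), (4 * (((m + i : ℕ) : ℚ) + 1) * (((m + i : ℕ) : ℚ) + k' + 1)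
              / ((2 * ((m + i : ℕ) : ℚ) + k' + 1) * (2 * ((m + i : ℕ) : ℚ) + k' + 2)))) * 1
            + ∑ i ∈ range (k' + 1), ((((m + i : ℕ) : ℚ) + k' + 1) * ((k' : ℚ) - 1)
              / ((2 * ((m + i : ℕ) : ℚ) + k' + 1) * (2 * ((m + i : ℕ) : ℚ) + k' + 2)))
              * ∏ l ∈ Finset.Ico (i + 1) (k' + 1), (4 * (((m + l : ℕ) : ℚ) + 1) * (((m + l : ℕ) : ℚ) + k' + 1)
              / ((2 * ((m + l : ℕ) : ℚ) + k' + 1) * (2 * ((m + l : ℕ) : ℚ) + k' + 2))) - 1)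
            * (((m : ℚ) + 2 * k' + 2) / ((m : ℚ) + k' + 1)) := by
  have hs : ∀ l, (1 : ℚ) ≤ 4 * (((m + l : ℕ) : ℚ) + 1) * (((m + l : ℕ) : ℚ) + k' + 1)
      / ((2 * ((m + l : ℕ) : ℚ) + k' + 1) * (2 * ((m + l : ℕ) : ℚ) + k' + 2)) := fun l =>
    borderPath_slope_ge_one k' (m + l) (by omega) hk
  have hA : (1 : ℚ) ≤ ∏ i ∈ range (k' + 1), (4 * (((m + i : ℕ) : ℚ) + 1) * (((m + i : ℕ) : ℚ) + k' + 1)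
      / ((2 * ((m + i : ℕ) : ℚ) + k' + 1) * (2 * ((m + i : ℕ) : ℚ) + k' + 2))) :=
    borderPath_one_le_prod _ _ (fun i _ => hs i)
  have hk1 : (1 : ℚ) ≤ k' := by exact_mod_cast (by omega : 1 ≤ k')
  have hB : ((k' : ℚ) + 1) * (((k' : ℚ) - 1) / (4 * ((m : ℚ) + 2 * k' + 2)))
      ≤ ∑ i ∈ range (k' + 1), ((((m + i : ℕ) : ℚ) + k' + 1) * ((k' : ℚ) - 1)
          / ((2 * ((m + i : ℕ) : ℚ) + k' + 1) * (2 * ((m + i : ℕ) : ℚ) + k' + 2)))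
          * ∏ l ∈ Finset.Ico (i + 1) (k' + 1), (4 * (((m + l : ℕ) : ℚ) + 1) * (((m + l : ℕ) : ℚ) + k' + 1)
          / ((2 * ((m + l : ℕ) : ℚ) + k' + 1) * (2 * ((m + l : ℕ) : ℚ) + k' + 2))) := by
    have hterm : ∀ i ∈ range (k' + 1), ((k' : ℚ) - 1) / (4 * ((m : ℚ) + 2 * k' + 2))
        ≤ ((((m + i : ℕ) : ℚ) + k' + 1) * ((k' : ℚ) - 1)
          / ((2 * ((m + i : ℕ) : ℚ) + k' + 1) * (2 * ((m + i : ℕ) : ℚ) + k' + 2)))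
          * ∏ l ∈ Finset.Ico (i + 1) (k' + 1), (4 * (((m + l : ℕ) : ℚ) + 1) * (((m + l : ℕ) : ℚ) + k' + 1)
          / ((2 * ((m + l : ℕ) : ℚ) + k' + 1) * (2 * ((m + l : ℕ) : ℚ) + k' + 2))) := by
      intro i hi
      rw [Finset.mem_range] at hi
      have h1 := borderPath_intercept_ge k' (m + i) (by omega)
      have h2 : ((k' : ℚ) - 1) / (4 * ((m : ℚ) + 2 * k' + 2)) ≤ ((k' : ℚ) - 1) / (4 * (((m + i : ℕ) : ℚ) + k' + 2)) := by
        apply div_le_div_of_nonneg_left (by linarith) (by positivity)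
        push_cast
        have : (i : ℚ) ≤ k' := by exact_mod_cast (by omega : i ≤ k')
        linarith
      have h3 : (1 : ℚ) ≤ ∏ l ∈ Finset.Ico (i + 1) (k' + 1), (4 * (((m + l : ℕ) : ℚ) + 1) * (((m + l : ℕ) : ℚ) + k' + 1)
          / ((2 * ((m + l : ℕ) : ℚ) + k' + 1) * (2 * ((m + l : ℕ) : ℚ) + k' + 2))) :=
        borderPath_one_le_prod _ _ (fun l _ => hs l)
      calc ((k' : ℚ) - 1) / (4 * ((m : ℚ) + 2 * k' + 2))
          ≤ (((m + i : ℕ) : ℚ) + k' + 1) * ((k' : ℚ) - 1)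
            / ((2 * ((m + i : ℕ) : ℚ) + k' + 1) * (2 * ((m + i : ℕ) : ℚ) + k' + 2)) := h2.trans h1
        _ = (((m + i : ℕ) : ℚ) + k' + 1) * ((k' : ℚ) - 1)
            / ((2 * ((m + i : ℕ) : ℚ) + k' + 1) * (2 * ((m + i : ℕ) : ℚ) + k' + 2)) * 1 := by ring
        _ ≤ _ := mul_le_mul_of_nonneg_left h3 (by
            apply div_nonneg _ (by positivity)
            exact mul_nonneg (by positivity) (by linarith))
    have := Finset.sum_le_sum hterm
    rw [Finset.sum_const, Finset.card_range, nsmul_eq_mul] at this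
    have e : ((k' + 1 : ℕ) : ℚ) = (k' : ℚ) + 1 := by push_cast; ring
    rw [e] at this
    exact this
  have hκ : (0 : ℚ) < ((m : ℚ) + 2 * k' + 2) / ((m : ℚ) + k' + 1) := by positivity
  set A := ∏ i ∈ range (k' + 1), (4 * (((m + i : ℕ) : ℚ) + 1) * (((m + i : ℕ) : ℚ) + k' + 1)
      / ((2 * ((m + i : ℕ) : ℚ) + k' + 1) * (2 * ((m + i : ℕ) : ℚ) + k' + 2))) with hAdef
  set B := ∑ i ∈ range (k' + 1), ((((m + i : ℕ) : ℚ) + k' + 1) * ((k' : ℚ) - 1)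
      / ((2 * ((m + i : ℕ) : ℚ) + k' + 1) * (2 * ((m + i : ℕ) : ℚ) + k' + 2)))
      * ∏ l ∈ Finset.Ico (i + 1) (k' + 1), (4 * (((m + l : ℕ) : ℚ) + 1) * (((m + l : ℕ) : ℚ) + k' + 1)
      / ((2 * ((m + l : ℕ) : ℚ) + k' + 1) * (2 * ((m + l : ℕ) : ℚ) + k' + 2))) with hBdef
  have hAB : B * (((m : ℚ) + 2 * k' + 2) / ((m : ℚ) + k' + 1)) ≤ (A * 1 + B - 1) * (((m : ℚ) + 2 * k' + 2) / ((m : ℚ) + k' + 1)) :=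
    mul_le_mul_of_nonneg_right (by linarith) hκ.le
  refine le_trans ?_ hAB
  calc ((k' : ℚ) + 1) * ((k' : ℚ) - 1) / (4 * ((m : ℚ) + k' + 1))
      = (((k' : ℚ) + 1) * (((k' : ℚ) - 1) / (4 * ((m : ℚ) + 2 * k' + 2))))
          * (((m : ℚ) + 2 * k' + 2) / ((m : ℚ) + k' + 1)) := by field_simp
    _ ≤ B * (((m : ℚ) + 2 * k' + 2) / ((m : ℚ) + k' + 1)) := mul_le_mul_of_nonneg_right hB hκ.le

/-- **The reduction on the regime where every slope is `≥ 1`** (`(k'+1)(k'−2) ≤ 2m`, i.e. `q ≥ k(k−3)/2`): the composed slope is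
`≥ 1`, so the affine function of `ρ′ ≥ 1` is smallest at `ρ′ = 1`: `L − Φ(q+k, q) ≥ Path(1) − T`. -/
theorem border_sub_phiK_ge_path_one (m k' : ℕ) (hk : 2 ≤ k') (hslope : (k' + 1) * (k' - 2) ≤ 2 * m) :
    (∑ j ∈ range (k' + 1), ((2 * k' + 2).choose (j + 1) : ℚ)
        * ∑ a ∈ range (m + 1), (m.choose a : ℚ) / ((m + k' + (j + 1) + a).choose (a + (j + 1)) : ℚ))
      - phiK (m + k' + (k' + 2)) (m + k')
      ≥ ((∏ i ∈ range (k' + 1), (4 * (((m + i : ℕ) : ℚ) + 1) * (((m + i : ℕ) : ℚ) + k' + 1)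
              / ((2 * ((m + i : ℕ) : ℚ) + k' + 1) * (2 * ((m + i : ℕ) : ℚ) + k' + 2)))) * 1
            + ∑ i ∈ range (k' + 1), ((((m + i : ℕ) : ℚ) + k' + 1) * ((k' : ℚ) - 1)
              / ((2 * ((m + i : ℕ) : ℚ) + k' + 1) * (2 * ((m + i : ℕ) : ℚ) + k' + 2)))
              * ∏ l ∈ Finset.Ico (i + 1) (k' + 1), (4 * (((m + l : ℕ) : ℚ) + 1) * (((m + l : ℕ) : ℚ) + k' + 1)
              / ((2 * ((m + l : ℕ) : ℚ) + k' + 1) * (2 * ((m + l : ℕ) : ℚ) + k' + 2))) - 1)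
            * (((m : ℚ) + 2 * k' + 2) / ((m : ℚ) + k' + 1))
        - ∑ j ∈ range (k' + 1), ((2 * k' + 2).choose (k' + 2 + j) : ℚ)
            * ∑ a ∈ range (m + 1), (m.choose a : ℚ) / ((m + k' + (k' + 2 + j) + a).choose (a + (k' + 2 + j)) : ℚ) := by
  have h : 1 ≤ m + k' := by omega
  have hb := border_sub_phiK_eq m k'
  have hp := rho_path_eq k' m h (k' + 1)
  rw [show 2 * (m + (k' + 1)) + k' = 2 * m + 3 * k' + 2 by ring, show m + (k' + 1) = m + k' + 1 by ring] at hp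
  have hs := rho_succ (2 * m + 3 * k' + 2) (m + k') (by omega)
  rw [show ((2 * m + 3 * k' + 2 : ℕ) : ℚ) - ((m + k' : ℕ) : ℚ) = (m : ℚ) + 2 * k' + 2 by push_cast; ring] at hs
  set A := ∏ i ∈ range (k' + 1), (4 * (((m + i : ℕ) : ℚ) + 1) * (((m + i : ℕ) : ℚ) + k' + 1)
      / ((2 * ((m + i : ℕ) : ℚ) + k' + 1) * (2 * ((m + i : ℕ) : ℚ) + k' + 2))) with hA
  set B := ∑ i ∈ range (k' + 1), ((((m + i : ℕ) : ℚ) + k' + 1) * ((k' : ℚ) - 1)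
      / ((2 * ((m + i : ℕ) : ℚ) + k' + 1) * (2 * ((m + i : ℕ) : ℚ) + k' + 2)))
      * ∏ l ∈ Finset.Ico (i + 1) (k' + 1), (4 * (((m + l : ℕ) : ℚ) + 1) * (((m + l : ℕ) : ℚ) + k' + 1)
      / ((2 * ((m + l : ℕ) : ℚ) + k' + 1) * (2 * ((m + l : ℕ) : ℚ) + k' + 2))) with hB
  set ρ' := (∑ i ∈ range (m + 1), ((2 * m + k').choose i : ℚ)) / ((2 * m + k').choose m : ℚ) with hρ'
  set ρq := (∑ i ∈ range (m + k' + 1), ((2 * m + 3 * k' + 2).choose i : ℚ)) / ((2 * m + 3 * k' + 2).choose (m + k') : ℚ) with hρq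
  set T := ∑ j ∈ range (k' + 1), ((2 * k' + 2).choose (k' + 2 + j) : ℚ)
            * ∑ a ∈ range (m + 1), (m.choose a : ℚ) / ((m + k' + (k' + 2 + j) + a).choose (a + (k' + 2 + j)) : ℚ) with hT
  set κ := ((m : ℚ) + 2 * k' + 2) / ((m : ℚ) + k' + 1) with hκ
  have hq1 : (∑ i ∈ range (m + k' + 1 + 1), ((2 * m + 3 * k' + 2).choose i : ℚ))
      / ((2 * m + 3 * k' + 2).choose (m + k' + 1) : ℚ) = A * ρ' + B := hp
  have hκ1 : (1 : ℚ) ≤ κ := by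
    rw [hκ, le_div_iff₀ (by positivity)]
    have : (0 : ℚ) ≤ k' := by positivity
    linarith
  have hρq_eq : ρq = (A * ρ' + B - 1) * κ := by
    have e := hq1.symm.trans hs
    push_cast at e
    have hd : (0 : ℚ) < (m : ℚ) + 2 * k' + 2 := by positivity
    have e2 : (A * ρ' + B - 1) * ((m : ℚ) + 2 * k' + 2) = ((m : ℚ) + k' + 1) * ρq := by
      have e3 : (A * ρ' + B) * ((m : ℚ) + 2 * k' + 2) = ((m : ℚ) + 2 * k' + 2) + ((m : ℚ) + k' + 1) * ρq := by
        rw [e]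
        field_simp
      linarith [e3]
    rw [hκ, mul_div_assoc', eq_div_iff (by positivity)]
    linarith [e2]
  have h1 : (1 : ℚ) ≤ ρ' := rho_ge_one (2 * m + k') m (by omega)
  have hA1 : (1 : ℚ) ≤ A := borderPath_one_le_prod _ _ (fun i _ => borderPath_slope_ge_one k' (m + i) (by omega) hk)
  have hpos : 0 ≤ A * κ - 1 := by nlinarith
  rw [hb]
  have hlin : (1 : ℚ) + ρq - ρ' - T = (A * κ - 1) * ρ' + (B - 1) * κ + 1 - T := by rw [hρq_eq]; ring
  rw [hlin]
  have : (A * κ - 1) * 1 ≤ (A * κ - 1) * ρ' := mul_le_mul_of_nonneg_left h1 hpos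
  linarith

/-- **THE BORDERLINE FROM THE TAIL BOUND, on `q ≥ k(k−3)/2`**: if `T ≤ (k−1)(k−3)/(4(q+1))` then `Φ(q+k, q) ≤ R̂(q, k, q−k+2)`
(`k = k' + 2`, `q = m + k'`, `(k'+1)(k'−2) ≤ 2m`). With the decay bound on `T` this is dossier §31.9(c). -/
theorem phiK_le_rhat_border_of_tail (m k' : ℕ) (hk : 2 ≤ k') (hslope : (k' + 1) * (k' - 2) ≤ 2 * m)
    (hT : ∑ j ∈ range (k' + 1), ((2 * k' + 2).choose (k' + 2 + j) : ℚ)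
            * ∑ a ∈ range (m + 1), (m.choose a : ℚ) / ((m + k' + (k' + 2 + j) + a).choose (a + (k' + 2 + j)) : ℚ)
      ≤ ((k' : ℚ) + 1) * ((k' : ℚ) - 1) / (4 * ((m : ℚ) + k' + 1))) :
    phiK (m + k' + (k' + 2)) (m + k') ≤ rhat (m + k') (k' + 2) m := by
  have hge := border_sub_phiK_ge_path_one m k' hk hslope
  have hp1 := path_one_ge m k' hk hslope
  have hL := rhatSliceL_le_rhat (m + k') (k' + 2) m
  rw [sum_Ioo_nat, show k' + 2 - (0 + 1) = k' + 1 by omega, show m + k' + (k' + 2) - m = 2 * k' + 2 by omega] at hL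
  simp only [zero_add] at hL
  have hre : ∑ j ∈ range (k' + 1), ((2 * k' + 2).choose (1 + j) : ℚ)
        * ∑ a ∈ range (m + 1), (m.choose a : ℚ) / ((m + k' + (1 + j) + a).choose (a + (1 + j)) : ℚ)
      = ∑ j ∈ range (k' + 1), ((2 * k' + 2).choose (j + 1) : ℚ)
        * ∑ a ∈ range (m + 1), (m.choose a : ℚ) / ((m + k' + (j + 1) + a).choose (a + (j + 1)) : ℚ) :=
    Finset.sum_congr rfl (fun j _ => by rw [Nat.add_comm 1 j])
  rw [hre] at hL
  linarith [hge, hp1, hL, hT]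

end PercRepro
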